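import Mathlib.Algebra.Order.Floor.Semiring
import Mathlib.Analysis.SpecialFunctions.Pow.Real
import Mathlib.FieldTheory.IntermediateField.Adjoin.Defs
import Mathlib.RingTheory.AlgebraicIndependent.Basic
import Literature.NumberTheory.Transcendental.ChudnovskyHeights
import Literature.NumberTheory.Transcendental.RoyCriterion
import HarnessLib

/-!
# Philippon's criterion for algebraic independence (the form used for large transcendence degrees)

Topic `Literature/NumberTheory/Transcendental` (trunk T-TRANSCEND). Decomposition step for the
named fact `Literature.NumberTheory.Transcendental.diaz_1989` / `Diaz1989_gridX` (`DiazLadder.lean`, `DiazGrid.lean`):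
the first tool in every proof of a "large transcendence degree" result for the values of the
exponential function (Philippon 1986, Diaz 1989; Nesterenko–Philippon (eds.) 2001, Ch. 14, §3) is
Philippon's criterion for algebraic independence. We vendor the special case printed as
Proposition 3.2 of LNM 1752, Ch. 14 (a consequence of the criteria of Philippon 1986 = LNM 1752,
Ch. 8, §1, Cor. 1.1), as the named fact `Philippon1986_criterion`.

Printed statement (verbatim, LNM 1752 Ch. 14, Prop. 3.2, PDF p. 251; `H(P)` is the usual height,
the maximum absolute value of the coefficients).

PROPOSITION 3.2. Let `a ≥ 1` be a real number and `θ = (θ₁, …, θ_q)` an element in `ℂ^q`. There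
exists a positive number `C` having the following property. Assume that for all sufficiently large
integer `N`, there exist a positive integer `m = m(N) ≥ 1` and polynomials `Q_{N1}, …, Q_{Nm}` in
`ℤ[X₁, …, X_q]` with `max_j deg Q_{Nj} ≤ N`, `max_j H(Q_{Nj}) ≤ e^N` and
`max_j |Q_{Nj}(θ₁, …, θ_q)| ≤ e^{-CN^a}` such that the polynomials `Q_{N1}, …, Q_{Nm}` have no common
zero in the domain `{z ∈ ℂ^q ; max_i |z_i - θ_i| ≤ e^{-3CN^a}}`. Then the transcendence degree `t`
of the field `ℚ(θ₁, …, θ_q)` over `ℚ` satisfies `t > a - 1`.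

Encodings: polynomials are `MvPolynomial (Fin q) ℤ`, `deg` is the total degree, `H` is
`Literature.NumberTheory.Transcendental.mvPolyHeight` (`RoyCriterion.lean`), evaluation is `MvPolynomial.aeval`, `N^a` is
`Real.rpow`, "for all sufficiently large `N`" is `∀ᶠ N in atTop`, and the conclusion `t > a - 1`
for the (integer, here cardinal) transcendence degree is written `⌊a⌋₊ ≤ t`
(`floor_le_iff_sub_one_lt`). Nothing is asserted; users take `(h : Philippon1986_criterion)`.

v2: the **main criterion** itself (Philippon 1986, Théorème 2.11, "critère principal"), in the
special case `K = ℚ`, `v = ∞`, integer polynomials, and in the transcendence-degree form in which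
Diaz applies it (J. Number Theory 31 (1989), p. 16, "Critère", deduced there from Thm 2.11): this
flexible form (four growth functions `σ, δ, R, S`) is what yields Diaz's `[(mn+m)/(m+n)]`
(the rigid form Prop. 3.2 above loses the case where that quotient is an integer for small `m`).

Printed statement (Philippon 1986, Thm 2.11, pp. 38–39, verbatim up to notation; `h̄` is the
invariant height of Def. 1.11: `h̄(P) = (1/[K:ℚ]) ∑_v n_v max(0, log M_v(P))`, `M_v` the Mahler
measure at the infinite places and the maximum of the `v`-adic absolute values of the coefficients
at the finite ones).

THÉORÈME (2.11) (critère principal). Soient `K` un corps de nombres, `v` une place de `K` et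
`θ = (θ₁, …, θ_n) ∈ ℂ_vⁿ`. On suppose qu'il existe un idéal premier `𝔓` de `K[X₁, …, X_n]` de
codimension `n - k` (`0 ≤ k ≤ n`) tel que pour tout `P ∈ 𝔓` on ait `P(θ₁, …, θ_n) = 0`. Soient
`σ, δ, R` et `S` quatre fonctions croissantes de `ℕ` dans l'ensemble des nombres réels `≥ 1`. On
suppose que `τ = σ + δ` tend vers l'infini avec `N`, que `S/τδ^k` est une fonction croissante de `ℕ`
dans `ℝ₊` et que pour tout `N ∈ ℕ` on a :
`S(N)^{k+2} ≥ C τ(N+1) δ(N+1)^k [S(N)^{k+1} + R(N+1)^{k+1}]`, où `C = C(n, [K:ℚ], 𝔓)` est un nombre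
réel `≥ 1` ne dépendant que de `n`, `[K:ℚ]` et `𝔓`. Sous ces hypothèses il n'existe pas de suite
d'idéaux `(I_N)_{N ≥ N₀}` de `K[X₁, …, X_n]` telle que pour tout `N ≥ N₀` l'ensemble des zéros de
`I_N` dans la boule fermée `B(θ, exp(-R(N)))` de `ℂ_vⁿ` soit de cardinal fini et que l'idéal `I_N`
soit engendré par des polynômes `Q₁^{(N)}, …, Q_{m(N)}^{(N)}` de degrés `≤ δ(N)`, de hauteurs
`h̄ ≤ σ(N)` et vérifiant `0 < max_{1≤i≤m(N)} {|Q_i^{(N)}(θ₁, …, θ_n)|_v} ≤ exp(-S(N))`.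

Reductions used in `Philippon1986_mainCriterion` (each only weakens the printed statement):
* `K = ℚ`, `v = ∞` (`ℂ_v = ℂ`), polynomials with integer coefficients (a subring of `ℚ[X]`);
* the height bound is imposed on `log L(Q)`, `L(Q) = ∑ |coefficients|` (the `ℓ¹`-norm
  `Literature.NumberTheory.Transcendental.Chudnovsky.l1` of `ChudnovskyHeights.lean`): for a non-zero `Q ∈ ℤ[X]`,
  `h̄(Q) = max(0, log M(Q)) ≤ log L(Q)` because the Mahler measure of `Q` is at most
  `sup_{|zᵢ|=1} |Q| ≤ L(Q)` and the finite places contribute `0`; for `Q = 0` both sides vanish;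
* the prime `𝔓` of codimension `n - k` vanishing at `θ` is replaced by its source, the hypothesis
  `trdeg_ℚ ℚ(θ) ≤ k`, in contrapositive form "such a sequence exists ⇒ `trdeg_ℚ ℚ(θ) ≥ k + 1`"
  (the ideal of `θ` is a prime of codimension `n - trdeg ℚ(θ) ≥ n - k` of the catenary ring
  `ℚ[X₁,…,X_n]`, hence contains a prime of codimension exactly `n - k`); this is the form printed by
  Diaz 1989, p. 16 ("Du critère … [9, théorème 2.11] on déduit facilement le corollaire suivant"),
  with his constant `c(q, E, [K:ℚ])`, `E` the ideal of `θ`, here allowed to depend on `k ≤ n` too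
  (equivalent, `k` ranging over finitely many values);
* the ball is the closed polydisc `max_i |z_i - θ_i| ≤ exp(-R(N))` (the norm "du max", Diaz p. 16).

## References

* P. Philippon, *Critères pour l'indépendance algébrique*, Publ. Math. IHÉS 64 (1986), 5–52
  (numdam.org/item/PMIHES_1986__64__5_0), Def. 1.11 (heights, p. 19), Thm 2.11 (pp. 38–39),
  Thm 2.12 (p. 40).
* G. Diaz, *Grands degrés de transcendance pour des familles d'exponentielles*, J. Number Theory
  31 (1989), 1–23, the "Critère" of p. 16 (Thm 2.11 in transcendence-degree form).
* Yu. V. Nesterenko, P. Philippon (eds.), *Introduction to Algebraic Independence Theory*,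
  LNM 1752, Springer 2001, Ch. 14 (M. Waldschmidt), Prop. 3.2, p. 251; Ch. 8 (P. Philippon), §1,
  Cor. 1.1, p. 165.
-/

noncomputable section

open MvPolynomial Filter

namespace Literature.NumberTheory.Transcendental

/-- **Philippon's criterion for algebraic independence**, in the form of Nesterenko–Philippon
(eds.) 2001, Ch. 14, Prop. 3.2 (special case of Philippon 1986): for `a ≥ 1` and `θ ∈ ℂ^q` there
is `C > 0` such that, if for all sufficiently large `N` there are `m ≥ 1` polynomials
`Q₁, …, Q_m ∈ ℤ[X₁, …, X_q]` of total degree `≤ N`, height `≤ e^N`, with `|Qⱼ(θ)| ≤ e^{-CN^a}` for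
all `j` and without common zero in the polydisc `max_i |z_i - θ_i| ≤ e^{-3CN^a}`, then
`trdeg_ℚ ℚ(θ) > a - 1`, i.e. `trdeg_ℚ ℚ(θ) ≥ ⌊a⌋`.
[cite: Philippon1986Criteres, criteria for algebraic independence (special case; = LNM 1752 Ch. 8 §1 Cor. 1.1)]
[cite: NesterenkoPhilippon2001, Ch. 14 Prop. 3.2, p. 251] -/
def Philippon1986_criterion : Prop :=
  ∀ (q : ℕ) (θ : Fin q → ℂ) (a : ℝ), 1 ≤ a → ∃ C : ℝ, 0 < C ∧
    ((∀ᶠ N : ℕ in atTop, ∃ (m : ℕ) (Q : Fin m → MvPolynomial (Fin q) ℤ), 1 ≤ m ∧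
        (∀ j, (Q j).totalDegree ≤ N) ∧
        (∀ j, (Literature.NumberTheory.Transcendental.mvPolyHeight (Q j) : ℝ) ≤ Real.exp N) ∧
        (∀ j, ‖aeval θ (Q j)‖ ≤ Real.exp (-(C * (N : ℝ) ^ a))) ∧
        ∀ z : Fin q → ℂ, (∀ i, ‖z i - θ i‖ ≤ Real.exp (-(3 * C * (N : ℝ) ^ a))) →
          ∃ j, aeval z (Q j) ≠ 0) →
      ((⌊a⌋₊ : ℕ) : Cardinal) ≤ Algebra.trdeg ℚ ↥(IntermediateField.adjoin ℚ (Set.range θ)))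

/-- The encoding of the conclusion: for an integer `t` and a real `a ≥ 0`, `t > a - 1` iff
`t ≥ ⌊a⌋` (Nesterenko–Philippon (eds.) 2001, Ch. 14, Remark after Thm 2.7). [folklore] -/
theorem floor_le_iff_sub_one_lt {a : ℝ} (ha : 0 ≤ a) (t : ℕ) : ⌊a⌋₊ ≤ t ↔ a - 1 < t := by
  rw [← Nat.lt_succ_iff, Nat.floor_lt ha]
  push_cast
  constructor <;> intro h <;> linarith

/-! ### v2: the main criterion (Philippon 1986, Théorème 2.11) for `K = ℚ`, `v = ∞` -/

/-- **Philippon's main criterion for algebraic independence** (Philippon 1986, Théorème 2.11,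
"critère principal"), case `K = ℚ`, `v = ∞`, integer polynomials, in the transcendence-degree form
of Diaz 1989, p. 16. Let `θ ∈ ℂⁿ` and `0 ≤ k ≤ n`. There is `C ≥ 1` (depending only on `n`, `k`
and `θ`) with the following property. Let `σ, δ, R, S : ℕ → ℝ` be non-decreasing with values `≥ 1`,
`σ + δ → ∞`, `N ↦ S(N)/((σ(N)+δ(N)) δ(N)^k)` non-decreasing, and
`S(N)^{k+2} ≥ C (σ(N+1)+δ(N+1)) δ(N+1)^k (S(N)^{k+1} + R(N+1)^{k+1})` for all `N`. Suppose that for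
all `N ≥ N₀` there are polynomials `Q_{N,1}, …, Q_{N,m(N)} ∈ ℤ[X₁,…,X_n]` of total degree `≤ δ(N)`
and `ℓ¹`-norm `log L(Q_{N,i}) ≤ σ(N)` (`L = Literature.Periods.Chudnovsky.l1`), having only finitely many common zeros in the closed polydisc
`max_i |z_i - θ_i| ≤ exp(-R(N))`, with `0 < max_i |Q_{N,i}(θ)| ≤ exp(-S(N))`. Then
`trdeg_ℚ ℚ(θ) ≥ k + 1`. (Printed form: under a prime `𝔓 ⊆ ker(P ↦ P(θ))` of codimension `n - k`,
i.e. when `trdeg_ℚ ℚ(θ) ≤ k`, no such sequence of ideals of `K[X]` with `h̄ ≤ σ` exists; see the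
module docstring for the reductions, each of which only weakens the source.)
Users take `(h : Philippon1986_mainCriterion)`.
[cite: Philippon1986Criteres, Théorème 2.11 (critère principal), pp. 38–39 (K = ℚ, v = ∞)]
[cite: Diaz1989, Critère, p. 16 (transcendence-degree form of Philippon's Thm 2.11)] -/
def Philippon1986_mainCriterion : Prop :=
  ∀ (n k : ℕ) (θ : Fin n → ℂ), k ≤ n → ∃ C : ℝ, 1 ≤ C ∧
    ∀ (σ δ R S : ℕ → ℝ), Monotone σ → Monotone δ → Monotone R → Monotone S →
      (∀ N, 1 ≤ σ N) → (∀ N, 1 ≤ δ N) → (∀ N, 1 ≤ R N) → (∀ N, 1 ≤ S N) →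
      Tendsto (fun N => σ N + δ N) atTop atTop →
      Monotone (fun N => S N / ((σ N + δ N) * δ N ^ k)) →
      (∀ N, C * (σ (N + 1) + δ (N + 1)) * δ (N + 1) ^ k * (S N ^ (k + 1) + R (N + 1) ^ (k + 1))
          ≤ S N ^ (k + 2)) →
      ∀ (N₀ : ℕ) (m : ℕ → ℕ) (Q : (N : ℕ) → Fin (m N) → MvPolynomial (Fin n) ℤ),
        (∀ N, N₀ ≤ N →
          Set.Finite {z : Fin n → ℂ | (∀ i, ‖z i - θ i‖ ≤ Real.exp (-R N)) ∧
              ∀ j, aeval z (Q N j) = 0} ∧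
          (∀ j, ((Q N j).totalDegree : ℝ) ≤ δ N) ∧
          (∀ j, Real.log (Literature.NumberTheory.Transcendental.Chudnovsky.l1 (Q N j)) ≤ σ N) ∧
          (∃ j, aeval θ (Q N j) ≠ 0) ∧
          (∀ j, ‖aeval θ (Q N j)‖ ≤ Real.exp (-S N))) →
        (((k + 1 : ℕ)) : Cardinal) ≤ Algebra.trdeg ℚ ↥(IntermediateField.adjoin ℚ (Set.range θ))

end Literature.NumberTheory.Transcendental


end
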